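import Summits.CriticalPhenomena.PercolationContinuityZ3.Theorems.Transplant.SitePhi
import Summits.CriticalPhenomena.PercolationContinuityZ3.Theorems.Transplant.SiteSetMarkov
import Summits.CriticalPhenomena.PercolationContinuityZ3.Theorems.Transplant.SiteVdBHK
import HarnessLib

/-!
# SITE percolation: LEMMA Φ(a) — the residual functional as a conditional mean (Markov property at the cluster of the avoided set,
# explored OFF a deleted vertex set)   (WP6 piece of P1-SITE-Z3 §12/§15; site twin of `Theorems/PercNearOneGluingNoHeavyLowerTailCSHPhiMarkov.lean`)

builds on p205010 (kernel theorem, internal audit signed; external expert review pending).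

* `worldDead_eq_deadOf` — the dead set of `X` in `ζ` is `SiteBHK.deadOf Γ X (C_X(ζ))`, `C_X = SiteBHK.setC Γ univ X`;
* `set_sum_cond_sdiff_off` — conditioning on the cluster `W = C_X(ω ∖ D)` of `X` explored OFF the vertex set `D`: the event reads only the
  states in `deadOf X W`, the world `ω ∖ deadOf X W` (which may contain vertices of `D`) is fresh (`blockFubini`);
* `wmeanOff` — the world mean `ḡ(ζ) = Σ_η w(η) g(C_s(η ∖ worldDead_X(ζ)))` (in `G`, NOT in `G − D`);
* **`sum_phiIntegrand_eq`** — LEMMA Φ(a): `Σ_η w(η) I_D(η) = Σ_η w(η)·1{s ↮ X in η ∖ D}·( ḡ(η ∖ D) − g(C_s(η ∖ D)) )`.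
Support file (`--supports stmt-CriticalPhenomena-4575 --as helper`); one sum-level definition (`wmeanOff`), no named facts, no sorries.
[cite: VandenbergHaggstromKahn2005, §2.1 Lemma 2.4 (p. 10); §1 pp. 7–8, display (10)] [cite: KozmaNitzan2024, Conj. 4 (p. 32)]
-/

noncomputable section

namespace Summit.CriticalPhenomena.PercolationContinuityZ3.Theorems.Transplant

namespace SiteCSH

open MeasureTheory Set
open Literature.Probability.Percolation
open Literature.Probability.Percolation.BHK2006 (weight weight_nonneg blockFubini)
open Literature.Probability.Percolation.DecisionTree (ind ind_of_mem ind_of_not_mem ind_nonneg)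
open SiteBHK (sC setC deadOf mem_setC sC_univ setC_eq_of_agree mem_sC_comm)
open scoped Classical

variable {V : Type*} [Fintype V] {Γ : SimpleGraph V}

/-- The dead set of `X` in `ζ` is the dead set of the value of the cluster of `X`. [folklore] -/
theorem worldDead_eq_deadOf (X : Set V) (ζ : Set V) :
    worldDead Γ X ζ = deadOf Γ X (setC Γ Finset.univ X ζ) := by
  ext u
  simp only [worldDead, deadOf, mem_setOf_eq, mem_setC, sC_univ]
  constructor
  · rintro (hu | ⟨y, hy, hu | ⟨z, hz, huz⟩⟩)
    · exact Or.inl hu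
    · exact Or.inr (Or.inl ⟨y, hy, hu⟩)
    · exact Or.inr (Or.inr ⟨z, ⟨y, hy, hz⟩, huz⟩)
  · rintro (hu | ⟨y, hy, hu⟩ | ⟨z, ⟨y, hy, hz⟩, huz⟩)
    · exact Or.inl hu
    · exact Or.inr ⟨y, hy, Or.inl hu⟩
    · exact Or.inr ⟨y, hy, Or.inr ⟨z, hz, huz⟩⟩

/-- `{s ↮ X}` in `ζ` iff `s ∉ C_X(ζ)`. [folklore] -/
theorem avoid_iff_not_mem_setC (s : V) (X : Set V) (ζ : Set V) :
    (∀ x ∈ X, x ∉ siteCluster Γ ζ s) ↔ s ∉ setC Γ Finset.univ X ζ := by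
  simp only [mem_setC, not_exists, not_and, sC_univ]
  refine forall₂_congr fun x _ => ?_
  rw [← sC_univ (Γ := Γ), ← sC_univ (Γ := Γ), mem_sC_comm]

/-- **Conditioning on the cluster of `X` explored off a deleted vertex set `D`.** [cite: VandenbergHaggstromKahn2005, §2.1 Lemma 2.4 (p. 10)] -/
theorem set_sum_cond_sdiff_off (w : V → ℝ) (hm : ∑ ω, weight w ω = 1) (X : Set V) (D : Set V)
    (K : Set V → Set V → ℝ) :
    ∑ ω, weight w ω * K (setC Γ Finset.univ X (ω \ D)) (ω \ deadOf Γ X (setC Γ Finset.univ X (ω \ D))) =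
      ∑ ω, weight w ω * ∑ η, weight w η *
        K (setC Γ Finset.univ X (ω \ D)) (η \ deadOf Γ X (setC Γ Finset.univ X (ω \ D))) := by
  -- the cylinder property of `{C_X(ω ∖ D) = W}` on `A = deadOf X W`: it reads only `ω ∩ A`
  have hcyl : ∀ (W ω : Set V), setC Γ Finset.univ X ((ω ∩ deadOf Γ X W) \ D) = W ↔ setC Γ Finset.univ X (ω \ D) = W := by
    intro W ω
    constructor
    · intro h
      exact setC_eq_of_agree h fun u hu => by
        simp only [mem_sdiff, mem_inter_iff]; exact ⟨fun h' => ⟨h'.1.1, h'.2⟩, fun h' => ⟨⟨h'.1, hu⟩, h'.2⟩⟩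
    · intro h
      exact setC_eq_of_agree h fun u hu => by
        simp only [mem_sdiff, mem_inter_iff]; exact ⟨fun h' => ⟨⟨h'.1, hu⟩, h'.2⟩, fun h' => ⟨h'.1.1, h'.2⟩⟩
  have key : ∀ W : Set V,
      ∑ ω, (if setC Γ Finset.univ X (ω \ D) = W then weight w ω * K W (ω \ deadOf Γ X W) else 0) =
      ∑ ω, (if setC Γ Finset.univ X (ω \ D) = W then weight w ω * ∑ η, weight w η * K W (η \ deadOf Γ X W) else 0) := by
    intro W
    set Φ : Set V → Set V → ℝ := fun ζ η => if setC Γ Finset.univ X (ζ \ D) = W then K W η else 0 with hΦ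
    have h1 : ∀ ω, (if setC Γ Finset.univ X (ω \ D) = W then weight w ω * K W (ω \ deadOf Γ X W) else 0) =
        weight w ω * Φ (ω ∩ deadOf Γ X W) (ω \ deadOf Γ X W) := by
      intro ω
      simp only [hΦ, hcyl]
      split_ifs with hW
      · rfl
      · rw [mul_zero]
    have h2 : ∀ ω, weight w ω * ∑ ω', weight w ω' * Φ (ω ∩ deadOf Γ X W) (ω' \ deadOf Γ X W) =
        (if setC Γ Finset.univ X (ω \ D) = W then weight w ω * ∑ η, weight w η * K W (η \ deadOf Γ X W) else 0) := by
      intro ω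
      simp only [hΦ, hcyl]
      split_ifs with hW
      · rfl
      · simp
    calc ∑ ω, (if setC Γ Finset.univ X (ω \ D) = W then weight w ω * K W (ω \ deadOf Γ X W) else 0)
        = (∑ ω, weight w ω) * ∑ ω, weight w ω * Φ (ω ∩ deadOf Γ X W) (ω \ deadOf Γ X W) := by
          rw [hm, one_mul]; exact Finset.sum_congr rfl fun ω _ => h1 ω
      _ = ∑ ω, weight w ω * ∑ ω', weight w ω' * Φ (ω ∩ deadOf Γ X W) (ω' \ deadOf Γ X W) := blockFubini w (deadOf Γ X W) Φ
      _ = _ := Finset.sum_congr rfl fun ω _ => h2 ω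
  calc ∑ ω, weight w ω * K (setC Γ Finset.univ X (ω \ D)) (ω \ deadOf Γ X (setC Γ Finset.univ X (ω \ D)))
      = ∑ ω, ∑ W, (if setC Γ Finset.univ X (ω \ D) = W then weight w ω * K W (ω \ deadOf Γ X W) else 0) :=
        Finset.sum_congr rfl fun ω _ =>
          (Fintype.sum_ite_eq (setC Γ Finset.univ X (ω \ D)) fun W => weight w ω * K W (ω \ deadOf Γ X W)).symm
    _ = ∑ W, ∑ ω, (if setC Γ Finset.univ X (ω \ D) = W then weight w ω * K W (ω \ deadOf Γ X W) else 0) := Finset.sum_comm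
    _ = ∑ W, ∑ ω, (if setC Γ Finset.univ X (ω \ D) = W then
          weight w ω * ∑ η, weight w η * K W (η \ deadOf Γ X W) else 0) := Finset.sum_congr rfl fun W _ => key W
    _ = ∑ ω, ∑ W, (if setC Γ Finset.univ X (ω \ D) = W then
          weight w ω * ∑ η, weight w η * K W (η \ deadOf Γ X W) else 0) := Finset.sum_comm
    _ = _ := Finset.sum_congr rfl fun ω _ =>
        Fintype.sum_ite_eq (setC Γ Finset.univ X (ω \ D)) fun W => weight w ω * ∑ η, weight w η * K W (η \ deadOf Γ X W)

variable (Γ) in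
/-- **The world mean** of `φ` given the cluster of `X` in `ζ`: `ḡ(ζ) = Σ_η w(η) φ(η ∖ worldDead_X(ζ))` (sum level; computed in `G`).
[cite: VandenbergHaggstromKahn2005, §2.1 Lemma 2.4 (p. 10)] -/
def wmeanOff (w : V → ℝ) (X : Set V) (φ : Set V → ℝ) (ζ : Set V) : ℝ :=
  ∑ η, weight w η * φ (η \ worldDead Γ X ζ)

/-- **Site Lemma Φ(a)**, sum level: `Σ_η w(η)·I_D(η) = Σ_η w(η)·1{s ↮ X in η ∖ D}·( ḡ(η ∖ D) − g(C_s(η ∖ D)) )`,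
`ḡ = wmeanOff w X (g ∘ C_s)` the world mean in `G` (NOT in `G − D`). [cite: VandenbergHaggstromKahn2005, §2.1 Lemma 2.4 (p. 10)] -/
theorem sum_phiIntegrand_eq (w : V → ℝ) (hm : ∑ ω, weight w ω = 1) (s : V) (X D : Set V) (g : Set V → ℝ) :
    ∑ η, weight w η * phiIntegrand Γ s X D g η =
      ∑ η, weight w η * (ind {ζ : Set V | ∀ x ∈ X, x ∉ siteCluster Γ ζ s} (η \ D) *
        (wmeanOff Γ w X (fun β => g (siteCluster Γ β s)) (η \ D) - g (siteCluster Γ (η \ D) s))) := by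
  -- unfold the integrand as an indicator times a difference
  have hI : ∀ η, phiIntegrand Γ s X D g η = ind {ζ : Set V | ∀ x ∈ X, x ∉ siteCluster Γ ζ s} (η \ D) *
      (g (siteCluster Γ (η \ worldDead Γ X (η \ D)) s) - g (siteCluster Γ (η \ D) s)) := by
    intro η
    unfold phiIntegrand
    by_cases h : ∀ x ∈ X, x ∉ siteCluster Γ (η \ D) s
    · rw [if_pos h, ind_of_mem (show η \ D ∈ {ζ : Set V | ∀ x ∈ X, x ∉ siteCluster Γ ζ s} from h), one_mul]
    · rw [if_neg h, ind_of_not_mem (show η \ D ∉ {ζ : Set V | ∀ x ∈ X, x ∉ siteCluster Γ ζ s} from h), zero_mul]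
  simp_rw [hI, mul_sub, Finset.sum_sub_distrib]
  congr 1
  -- the Markov identity for the first term, kernel `K(W, β) = 1{s ∉ W} · g(C_s(β))`
  set Kk : Set V → Set V → ℝ := fun W β => (if s ∈ W then 0 else 1) * g (siteCluster Γ β s) with hKk
  have hind : ∀ ζ : Set V, ind {ζ : Set V | ∀ x ∈ X, x ∉ siteCluster Γ ζ s} ζ =
      (if s ∈ setC Γ Finset.univ X ζ then 0 else 1) := by
    intro ζ
    by_cases h : s ∈ setC Γ Finset.univ X ζ
    · rw [if_pos h, ind_of_not_mem (show ζ ∉ {ζ : Set V | ∀ x ∈ X, x ∉ siteCluster Γ ζ s} from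
        fun h' => (avoid_iff_not_mem_setC s X ζ).1 h' h)]
    · rw [if_neg h, ind_of_mem (show ζ ∈ {ζ : Set V | ∀ x ∈ X, x ∉ siteCluster Γ ζ s} from
        (avoid_iff_not_mem_setC s X ζ).2 h)]
  have key := set_sum_cond_sdiff_off w hm X D Kk (Γ := Γ)
  have lhs : ∀ η, weight w η * (ind {ζ : Set V | ∀ x ∈ X, x ∉ siteCluster Γ ζ s} (η \ D) *
      g (siteCluster Γ (η \ worldDead Γ X (η \ D)) s)) =
      weight w η * Kk (setC Γ Finset.univ X (η \ D)) (η \ deadOf Γ X (setC Γ Finset.univ X (η \ D))) := by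
    intro η; rw [hKk, hind, worldDead_eq_deadOf]
  have rhs : ∀ η, weight w η * (ind {ζ : Set V | ∀ x ∈ X, x ∉ siteCluster Γ ζ s} (η \ D) *
      wmeanOff Γ w X (fun β => g (siteCluster Γ β s)) (η \ D)) =
      weight w η * ∑ η', weight w η' * Kk (setC Γ Finset.univ X (η \ D)) (η' \ deadOf Γ X (setC Γ Finset.univ X (η \ D))) := by
    intro η
    rw [hind, wmeanOff, Finset.mul_sum, worldDead_eq_deadOf]
    congr 1
    refine Finset.sum_congr rfl fun η' _ => ?_
    rw [hKk]; ring
  rw [Finset.sum_congr rfl fun η _ => lhs η, key]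
  exact (Finset.sum_congr rfl fun η _ => rhs η).symm

end SiteCSH

end Summit.CriticalPhenomena.PercolationContinuityZ3.Theorems.Transplant
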